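import Summits.NavierStokesRegularity.NavierStokesRegularity.Theorems.SqueezeCycleExtremalElementExistsExtraction
import Literature.Analysis.FluidPDE.OseenMildSmallRateLiouville
import Summits.NavierStokesRegularity.NavierStokesRegularity.Theorems.StrainDoorsTypeIRecentring
import Literature.Analysis.FluidPDE.TypeIAncientMildRescale
import Literature.Analysis.FluidPDE.CurlFreeLiouville
import HarnessLib

/-!
# StrainDoorsTypeIAncientCompactness — the two typed inputs (P1), (P2) of door K5′ (ROUND 65 §M20) ARE THEOREMS

LEAD plate of the S-door lane (ns-s30-p1 g6; helper lane of `stmt-NavierStokesRegularity-0056`, rung N0;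
`--supports stmt-NavierStokesRegularity-0056 --as helper`).  No new definitions; no sorry.

ROUND 65 of the ns-regularity-ideate cell (nsreg-p1 g37, text N2 `StrainDoorsDirectionDoorK5Endpoint`) types door K5′
`PeakDirectionSpreadFloor` and reduces it (ROUND-66 target `K5FloorReduction`) to two INPUTS on the Type-I ancient mild
class `A_C = IsTypeIAncientMild C` (KNSS/Oseen gauge), both marked «Not proved here»:
(P1) «SmallVorticityNumberLiouville» — `∀ C, ∃ η(C) > 0`, every `u ∈ A_C` with scale-invariant vorticity number
`sup_{s<0,y} (0 − s)|ω(s,y)| ≤ η` vanishes; (P2) «TypeIAncientCompactness C» — `A_C` is sequentially compact under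
pointwise convergence of the fields AND of their curls.  This file PROVES BOTH, with the statements written out
literally (the by-name discharges `smallVorticityNumberLiouville_holds`, `typeIAncientCompactness_holds` follow in
`StrainDoorsDirectionDoorK5Inputs` once N2's definitions are in the tree):

* ★★★ `exists_limit_of_isTypeIAncientMild_seq` — (P2): COMPOSITION of the tree's `C¹_loc` compactness of `A_C`
  (`exists_tendsto_of_isTypeIAncientMild_seq`, route SqueezeCycle: Arzelà–Ascoli on the pairs `(u, ∇u)` with the
  class-uniform bounds of KNSS 2009 §4, the Oseen identity passing to the limit) with `curl = curlCLM ∘ ∇`;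
* ★★ `eq_zero_of_typeIAncientMild_of_curl_eq_zero` — an IRROTATIONAL member of `A_C` vanishes (curl-free +
  divergence-free + bounded slices are constant, `eq_of_curl_eq_zero_of_isDivFree_of_bounded` = KNSS Lemma 3.1;
  the gauge kills slice-constant members, `IsTypeIAncientMild.eq_zero_of_slice_const` = KNSS Remark 6.1);
* ★★ `exists_large_scaledVelocity_of_ne_zero` — a NON-TRIVIAL member of `A_C` has a point with
  `√(−t)|u(t,x)| > ε₀` (contrapositive of the small-scaled-velocity Liouville theorem for Oseen-mild fields,
  `Literature.Analysis.FluidPDE.eq_zero_of_oseenMild_of_small_typeITime`, Chae–Wolf 2017 §3 Step 1 — v2 of this file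
  cites the Literature home instead of route ExtremalTypeIConstant's copy, leaving that route's theses cone);
* ★★★ `eq_zero_of_typeIAncientMild_of_small_vorticityNumber` — (P1), PROVED BY COMPACTNESS (not by the memo's
  Duhamel-with-logarithm sketch): were it false for `C`, there would be `u_j ∈ A_C`, `u_j ≢ 0`, with vorticity
  numbers `≤ 1/(j+1)`; pick `(t_j,x_j)` with `√(−t_j)|u_j(t_j,x_j)| > ε₁`, translate `x_j` to `0` and rescale `t_j`
  to `−1` (`IsTypeIAncientMild.comp_add_right`, `.nsRescale` — `A_C` and the vorticity number are invariant),
  extract by (P2): the limit `W ∈ A_C` has `|W(−1,0)| ≥ ε₁ > 0` and `curl W ≡ 0` — contradiction.  The threshold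
  `η(C)` is ineffective (compactness), and depends on `C` as N2's K2 note demands.

WHAT THIS IS NOT: Liouville/compactness statements about the HYPOTHETICAL class of Type-I blow-up profiles; they
turn ROUND 65's (P1), (P2) into theorems, so that door K5′ hinges on `K5FloorReduction` alone; nothing here excludes
a blow-up; `0056` / `10661` / NS regularity are NOT proved; the peak doors of PART K stay OPEN.
[cite: KochNadirashviliSereginSverak2009, Lemma 3.1, §4, Lemma 6.1, Remark 6.1 (arXiv:0709.3599)]
-/

noncomputable section

open MeasureTheory Set Function Filter Metric Real InnerProductSpace
open _root_.Topology
open scoped ENNReal NNReal RealInnerProductSpace ContDiff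
open Literature.Analysis Literature.Analysis.FluidPDE

set_option linter.dupNamespace false

namespace Summit.NavierStokesRegularity.NavierStokesRegularity.Theorems.StrainDoors

/-! ## §1 (P2): compactness of `A_C` with curls -/

/-- ★★★ **(P2) «TypeIAncientCompactness» IS A THEOREM.**  For every `C` and every sequence `u_j ∈ A_C` there are a
subsequence `φ` and `w ∈ A_C` with `u_{φ j}(t,x) → w(t,x)` and `curl u_{φ j}(t,·)(x) → curl w(t,·)(x)` for all `t < 0`,
`x` — literally the body of ROUND 65's `TypeIAncientCompactness C`.  (Tree `exists_tendsto_of_isTypeIAncientMild_seq`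
gives the fields and the GRADIENTS; `curl = curlCLM ∘ ∇`.) [tree composition; KNSS 2009 Lemma 6.1, Prop 4.1] -/
theorem exists_limit_of_isTypeIAncientMild_seq (C : ℝ) :
    ∀ u : ℕ → ℝ → EuclideanSpace ℝ (Fin 3) → EuclideanSpace ℝ (Fin 3), (∀ j, IsTypeIAncientMild C (u j)) →
      ∃ (w : ℝ → EuclideanSpace ℝ (Fin 3) → EuclideanSpace ℝ (Fin 3)) (φ : ℕ → ℕ), StrictMono φ ∧
        IsTypeIAncientMild C w ∧ ∀ t : ℝ, t < 0 → ∀ x : EuclideanSpace ℝ (Fin 3),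
          Tendsto (fun j => u (φ j) t x) atTop (𝓝 (w t x)) ∧
          Tendsto (fun j => curl (u (φ j) t) x) atTop (𝓝 (curl (w t) x)) := by
  intro u hu
  obtain ⟨φ, hφ, W, hW, hpt, hgrad, -, -⟩ := exists_tendsto_of_isTypeIAncientMild_seq C hu
  refine ⟨W, φ, hφ, hW, fun t ht x => ⟨hpt t ht x, ?_⟩⟩
  have h := ((curlCLM).continuous.tendsto _).comp (hgrad t ht x)
  simpa only [curl_eq_curlCLM, Function.comp_def] using h

/-! ## §2 Two Liouville steps in `A_C` -/

/-- ★★ **An irrotational member of `A_C` vanishes.**  If `W ∈ A_C` has `curl W(t,·) ≡ 0` for every `t < 0`, then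
`W ≡ 0`: each slice is `C^∞`, divergence free, curl free and bounded by `C/√(−t)`, hence CONSTANT
(`eq_of_curl_eq_zero_of_isDivFree_of_bounded`, KNSS Lemma 3.1), and the Oseen gauge kills slice-constant members
(`IsTypeIAncientMild.eq_zero_of_slice_const`, KNSS Remark 6.1). [tree composition] -/
theorem eq_zero_of_typeIAncientMild_of_curl_eq_zero {C : ℝ}
    {W : ℝ → EuclideanSpace ℝ (Fin 3) → EuclideanSpace ℝ (Fin 3)} (hW : IsTypeIAncientMild C W)
    (hcurl : ∀ t : ℝ, t < 0 → ∀ x, curl (W t) x = 0) :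
    ∀ t : ℝ, t < 0 → ∀ x : EuclideanSpace ℝ (Fin 3), W t x = 0 := by
  have hconst : ∀ t : ℝ, t < 0 → ∀ x, W t x = W t 0 := fun t ht x =>
    eq_of_curl_eq_zero_of_isDivFree_of_bounded ((hW.contDiff_slice ht).of_le (by norm_cast))
      (hcurl t ht) (hW.isDivFree ht) (fun y => hW.norm_le ht y) x 0
  intro t ht x
  exact hW.eq_zero_of_slice_const (b := fun s => W s 0) (fun s hs y => hconst s hs y) ht x

/-- ★★ **Non-trivial members of `A_C` have a point of large scaled velocity**: with the ABSOLUTE constant `ε₀` of the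
Literature lemma `Literature.Analysis.FluidPDE.eq_zero_of_oseenMild_of_small_typeITime` (Chae–Wolf 2017 §3 Step 1:
Oseen-mild fields with `√(−t)|u| ≤ ε₀` vanish; route-independent home of the ExtremalTypeIConstant route's copy), every `u ∈ A_C` (any `C`) with `u ≢ 0` has `√(−t)|u(t,x)| > ε₀` at
some `(t,x)`, `t < 0` (a member of `A_C` is Oseen-mild in the kernel form, `isTypeIAncientMild_iff`).
[tree composition; Chae–Wolf 2017 §3 Step 1 / KNSS 2009 small data] -/
theorem exists_large_scaledVelocity_of_ne_zero :
    ∃ ε₀ : ℝ, 0 < ε₀ ∧ ∀ {C : ℝ} {u : ℝ → EuclideanSpace ℝ (Fin 3) → EuclideanSpace ℝ (Fin 3)},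
      IsTypeIAncientMild C u → (∃ t : ℝ, t < 0 ∧ ∃ x, u t x ≠ 0) →
        ∃ t : ℝ, t < 0 ∧ ∃ x, ε₀ < √(-t) * ‖u t x‖ := by
  obtain ⟨ε₀, hε₀, hL⟩ := Literature.Analysis.FluidPDE.eq_zero_of_oseenMild_of_small_typeITime
  refine ⟨ε₀, hε₀, fun {C} {u} h hne => ?_⟩
  by_contra hcon
  push Not at hcon
  obtain ⟨t, ht, x, hx⟩ := hne
  exact hx (hL (isTypeIAncientMild_iff.1 h).2.2.1 hcon t ht x)

/-- `curl` commutes with space translations: `curl (f(· + a))(y) = curl f (y + a)`. [folklore] -/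
theorem curl_comp_add_right_apply (f : EuclideanSpace ℝ (Fin 3) → EuclideanSpace ℝ (Fin 3))
    (a y : EuclideanSpace ℝ (Fin 3)) : curl (fun z => f (z + a)) y = curl f (y + a) := by
  rw [curl_eq_curlCLM, curl_eq_curlCLM, fderiv_comp_add_right]

/-! ## §3 (P1): the small-vorticity-number Liouville theorem in `A_C` -/

/-- ★★★ **(P1) «SmallVorticityNumberLiouville» IS A THEOREM.**  For every `C` there is `η = η(C) > 0` such that every
`u ∈ A_C` with `(0 − s)|ω(s,y)| ≤ η` for all `s < 0`, `y` vanishes identically — literally the body of ROUND 65's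
`SmallVorticityNumberLiouville`.  PROOF BY COMPACTNESS: otherwise there are `u_j ∈ A_C`, `u_j ≢ 0`, with vorticity
numbers `≤ 1/(j+1)`; `exists_large_scaledVelocity_of_ne_zero` gives `(t_j, x_j)` with `√(−t_j)|u_j(t_j,x_j)| > ε₁`;
the normalised fields `U_j = nsRescale √(−t_j) (u_j(·, · + x_j)) ∈ A_C` have `|U_j(−1,0)| > ε₁` and the same
vorticity numbers; the class compactness (§1) yields `W ∈ A_C` with `|W(−1,0)| ≥ ε₁` and `curl W ≡ 0` (limits of
curls bounded by `1/((φ j)+1)/(0 − s) → 0`); `eq_zero_of_typeIAncientMild_of_curl_eq_zero` gives `W ≡ 0` —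
contradiction.  `η(C)` is ineffective and depends on `C` (N2, K2 note). [new composition of tree theorems;
cite: KochNadirashviliSereginSverak2009, §4, Lemma 6.1, Remark 6.1 (arXiv:0709.3599)] -/
theorem eq_zero_of_typeIAncientMild_of_small_vorticityNumber :
    ∀ C : ℝ, ∃ η : ℝ, 0 < η ∧ ∀ u : ℝ → EuclideanSpace ℝ (Fin 3) → EuclideanSpace ℝ (Fin 3),
      IsTypeIAncientMild C u →
      (∀ s : ℝ, s < 0 → ∀ y : EuclideanSpace ℝ (Fin 3), (0 - s) * ‖curl (u s) y‖ ≤ η) →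
        ∀ t : ℝ, t < 0 → ∀ x : EuclideanSpace ℝ (Fin 3), u t x = 0 := by
  intro C
  by_contra hcon
  push Not at hcon
  -- a bad sequence with vorticity numbers `≤ 1/(j+1)`
  have hseq : ∀ j : ℕ, ∃ u : ℝ → EuclideanSpace ℝ (Fin 3) → EuclideanSpace ℝ (Fin 3),
      IsTypeIAncientMild C u ∧
      (∀ s : ℝ, s < 0 → ∀ y : EuclideanSpace ℝ (Fin 3), (0 - s) * ‖curl (u s) y‖ ≤ 1 / ((j : ℝ) + 1)) ∧
      ∃ t : ℝ, t < 0 ∧ ∃ x : EuclideanSpace ℝ (Fin 3), u t x ≠ 0 := by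
    intro j
    obtain ⟨u, hu, hsmall, t, ht, x, hx⟩ := hcon (1 / ((j : ℝ) + 1)) (by positivity)
    exact ⟨u, hu, hsmall, t, ht, x, hx⟩
  choose u hu hsmall hne using hseq
  -- points of large scaled velocity
  obtain ⟨ε₁, hε₁pos, hlarge⟩ := exists_large_scaledVelocity_of_ne_zero
  have hbig : ∀ j, ∃ t : ℝ, t < 0 ∧ ∃ x : EuclideanSpace ℝ (Fin 3), ε₁ < √(-t) * ‖u j t x‖ :=
    fun j => hlarge (hu j) (hne j)
  choose t ht x hx using hbig
  -- normalisation: translate `x j` to the origin, rescale `t j` to `−1`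
  set lam : ℕ → ℝ := fun j => √(-t j) with hlam
  have hlam_pos : ∀ j, 0 < lam j := fun j => Real.sqrt_pos.mpr (by linarith [ht j])
  have hlam_sq : ∀ j, lam j ^ 2 = -t j := fun j => Real.sq_sqrt (by linarith [ht j])
  set U : ℕ → ℝ → EuclideanSpace ℝ (Fin 3) → EuclideanSpace ℝ (Fin 3) :=
    fun j => nsRescale (lam j) (fun s y => u j s (y + x j)) with hU
  have hUclass : ∀ j, IsTypeIAncientMild C (U j) := fun j =>
    ((hu j).comp_add_right (x j)).nsRescale (hlam_pos j)
  have hU0 : ∀ j, U j (-1) 0 = lam j • u j (t j) (x j) := by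
    intro j
    simp only [hU, nsRescale_apply, smul_zero, zero_add, mul_neg, mul_one, hlam_sq, neg_neg]
  have hUbig : ∀ j, ε₁ < ‖U j (-1) 0‖ := by
    intro j
    rw [hU0, norm_smul, Real.norm_of_nonneg (hlam_pos j).le]
    exact hx j
  have hUcurl : ∀ j, ∀ s : ℝ, s < 0 → ∀ y : EuclideanSpace ℝ (Fin 3),
      (0 - s) * ‖curl (U j s) y‖ ≤ 1 / ((j : ℝ) + 1) := by
    intro j s hs y
    have hcs : lam j ^ 2 * s < 0 := mul_neg_of_pos_of_neg (pow_pos (hlam_pos j) 2) hs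
    have h1 := hsmall j (lam j ^ 2 * s) hcs (lam j • y + x j)
    have e : curl (U j s) y = lam j ^ 2 • curl (u j (lam j ^ 2 * s)) (lam j • y + x j) := by
      simp only [hU, curl_nsRescale, curl_comp_add_right_apply]
    rw [e, norm_smul, Real.norm_of_nonneg (pow_pos (hlam_pos j) 2).le]
    calc (0 - s) * (lam j ^ 2 * ‖curl (u j (lam j ^ 2 * s)) (lam j • y + x j)‖)
        = (0 - lam j ^ 2 * s) * ‖curl (u j (lam j ^ 2 * s)) (lam j • y + x j)‖ := by ring
      _ ≤ 1 / ((j : ℝ) + 1) := h1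
  -- extraction
  obtain ⟨W, φ, hφ, hW, hlim⟩ := exists_limit_of_isTypeIAncientMild_seq C U hUclass
  -- the limit is large at `(−1, 0)`
  have hW0 : ε₁ ≤ ‖W (-1) 0‖ :=
    ge_of_tendsto (((hlim (-1) (by norm_num) 0).1).norm) (Eventually.of_forall fun j => (hUbig (φ j)).le)
  -- the limit is irrotational
  have hWcurl : ∀ s : ℝ, s < 0 → ∀ y : EuclideanSpace ℝ (Fin 3), curl (W s) y = 0 := by
    intro s hs y
    have hsmall' : ∀ j, ‖curl (U (φ j) s) y‖ ≤ (1 / (((φ j : ℕ) : ℝ) + 1)) / (0 - s) := by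
      intro j
      rw [le_div_iff₀ (by linarith), mul_comm]
      exact hUcurl (φ j) s hs y
    have hzero : Tendsto (fun j => (1 / (((φ j : ℕ) : ℝ) + 1)) / (0 - s)) atTop (𝓝 0) := by
      have h1 : Tendsto (fun j => ((φ j : ℕ) : ℝ)) atTop atTop :=
        tendsto_natCast_atTop_atTop.comp hφ.tendsto_atTop
      have h2 : Tendsto (fun j => ((φ j : ℕ) : ℝ) + 1) atTop atTop :=
        tendsto_atTop_add_const_right _ _ h1
      have h3 : Tendsto (fun j => 1 / (((φ j : ℕ) : ℝ) + 1)) atTop (𝓝 0) :=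
        tendsto_const_nhds.div_atTop h2
      simpa using h3.div_const (0 - s)
    have hnorm : Tendsto (fun j => ‖curl (U (φ j) s) y‖) atTop (𝓝 0) :=
      squeeze_zero (fun j => norm_nonneg _) hsmall' hzero
    exact norm_eq_zero.mp (tendsto_nhds_unique ((hlim s hs y).2).norm hnorm)
  -- an irrotational member of `A_C` vanishes
  have hWzero := eq_zero_of_typeIAncientMild_of_curl_eq_zero hW hWcurl (-1) (by norm_num) 0
  rw [hWzero, norm_zero] at hW0
  exact absurd hW0 (not_le.mpr hε₁pos)

end Summit.NavierStokesRegularity.NavierStokesRegularity.Theorems.StrainDoors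

end
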